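/- Copyright: the b2b-balaban cell (near-miss cell 7), T⁴-continuum fan-out; row NE7b CRUX team (2), seat
t4-ne7b-formalise-leaf-02 (gens 27–28; the row owner's INTERFACE REQUEST NE7b IR-44-1 «→ S12-W crew (leaf-03 custodian; E-files
leaf-02; leaf-05)», HOME/INBOX.md l.7662, `CLAIMS.log` l.30796, E-side END-level part E4TV — the pinned END over the
memory-agnostic carrier AT `κ := costT` WITH THE VOLUME's WEIGHTED CLASS REMAINDER DISPLAYED and the SPLIT slack).  Released
under the licence of the surrounding project. -/
import Summits.QuantumFields.BalabanUV.T4Continuum.Support.HistoryRealiseCellsRunMultEndDWTV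
import Summits.QuantumFields.BalabanUV.T4Continuum.Support.HistoryRealiseCellsRunPinnedT3b

/-!
# Realised histories: THE END OF RECORD v3′ UNDER THE TWO PINS, MEMORY-AGNOSTIC CARRIER, `κ := costT`, WEIGHTED CLASS
REMAINDER DISPLAYED, SPLIT SLACK (`…RunW_pinnedT3bDTV`; INTERFACE REQUEST NE7b IR-44-1 (2), E-side, file E4TV)

Summits-side support leaf of the T⁴-continuum cell (rung (B)+1 on a FINITE torus only; NOT infinite volume, NOT the
mass gap, NOT the Clay statement; NOT a proof of the spine estimate NE7b, which is the cell's OWN estimate, NOT PRINTED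
and NOT PROVED).  Row NE7b, route «COUNT» ∕ R-P1, re-open object (α), brick M5-2 «the witness plug»; row S12-W of
`t4/b2b-balaban-t4-ne7b-p1/LEAVES-NE7b.md`; the owner's IR-44-1 (`CLAIMS.log` l.30796, `HOME/INBOX.md` l.7662) item (2)
«the END-level twins at `κ := costT` with the volume's weighted class remainder displayed», as split by the S12-W
custodian leaf-03 (`CLAIMS.log` l.30922: W-files W5TV∕W6TV∕W7TV → leaf-03, E-files → leaf-02, bottom bricks M-WV∕T1V →
leaf-05): E4TV = the `κ := costT` ∕ weighted-volume twin of this seat's E4T `HistoryRealiseCellsRunPinnedT3bWT` (p259118).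

WHY.  IR-44-1 re-types the READ per-term price sentence of H3^NE7b: instead of two realised-cost families `κ κ′` with
their total-form readings `lifeCost … (κ K q) q.2 ≤ lifeCost … (costT Prod.fst C K (R K)) q.2` (E4T), the price is read
AT the model's booked cost `costT Prod.fst C K (R K)` and the volume's class remainder of brick M5-2 rides as ONE displayed
weight family `uV : ℕ → ℕ → ℝ` through the factor `Real.exp (birthWT Prod.fst (uV K) q.2)` (the births' weighted total,
`HistoryBankingVolumePlug.birthWT`), under the display D-V1 `uV K j ≤ θᵥ·p0Profile C.A₀ C.p₀ (g_K j)²` at the priced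
members' birth events and the SPLIT class-linear slack `C.a + (θ + θᵥ) ≤ ½γ₀A₁²`.  THIS FILE re-plugs E4T's pinned END
accordingly, over leaf-03's W-END of record `HistoryRealiseCellsRunMultEndDWTV.hybridNE7_of_realisedDomainsRunW_printedT3bDTV`
(IR-44-1 W-side, W7TV; below it W6TV∕W5TV (leaf-03), T1V∕M-WV (leaf-05), the owner's END socket
`HistoryAssemblyPriceWeighted` p264613): statement = E4T's with EXACTLY the token map (i) `∀ (κ κ′ …)` + the two
total-form cost clauses ↦ `∀ (uV : ℕ → ℕ → ℝ)` + D-V1, (ii) the two price sentences at `costT Prod.fst C K (R K)` with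
`* Real.exp (birthWT Prod.fst (uV K) q.2)`, (iii) `{θ θᵥ : ℝ}`, `hslack : C.a + (θ + θᵥ) ≤ ½γ₀A₁²`; proof = E4T's with
`κ κ′ hκ hκ′ ↦ uV huV` and `…printedT3bDT ↦ …printedT3bDTV`; the thresholds (`γ₁ := min γ₁ᶠ γB`,
`g₁ := min 1 (exp (−irThresholdTLE C F.L rr β₀ ∕ 2))`, `Em := max (em g) 0`) and the by-name discharges
(`HistoryFlow.flowSide_of_betaPertHyp`, `HistoryRealiseCellsRunPinned.beta0_le_of_L_mul_le` ∕ `…le_log_inv_sq_of_le_exp` ∕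
`…four_le_L` — all carrier- and cost-free) are UNCHANGED; the conclusion is BYTE-IDENTICAL to E4T's (and E4's).  At
`uV K := 0`, `θᵥ := 0` (factor `Real.exp (birthWT Prod.fst 0 q.2) = 1`, `HistoryRealiseCellsRunHeadlineT3bWTVS.exp_birthWT_zero`)
this END is E4T's at `κ := κ′ := costT Prod.fst C` (the meeting point leaf-01-g31 closed in the kernel one level down, on
T1∕T1V, `CLAIMS.log` l.31131).  The witness-level record of the same request —
`HistoryRealiseCellsRunApexT3bWTVS` p265435 ∕ `HistoryRealiseCellsRunHeadlineT3bWTVS` p266167 (this seat, gen 27; the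
`reslack` device) — is the OTHER reading of IR-44-1 (3); this file is the END-level RECORD of (2) with every binder
explicit, the one a `Ξ`-re-cut (Q-44-1) would edit.  Append-only: E4T, E4 and every earlier END stay, UNCHANGED BY NAME.

WHAT.  **`hybridNE7_of_realisedDomainsRunW_pinnedT3bDTV`** = E4T's pinned END with the H3 realised-cost binders GONE (price
sentences at the model's booked cost `costT`), ONE displayed weight family `uV` with its display D-V1 (`uV K j ≤ θᵥ·p₀(g_j)²`
at the priced members' births) carrying the volume's class remainder `e^{birthWT Prod.fst (uV K) q.2}` inside the price
sentences, and the split slack `C.a + (θ + θᵥ) ≤ ½γ₀A₁²`; everything else VERBATIM; conclusion VERBATIM.  [folklore]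
composition by name; no `def`, no `[cite:]` tag, nothing printed asserted, no `Prop` fact minted (c1), zero `sorry`.

HONEST.  DISPLAYED, NOT DISCHARGED: H3^NE7b's `realised` reading (`RealisedDomainsRW`), the price sentences' CREDIT part
(located question Q-44-1) and `resumM`, the numerator readings, (B) `B16.EndStatementBPrinted`, `BetaPertHyp`, NE7c's
`ShellWeightBound`, NE7's `ReindexedBudget` + four summable rates, END v3′'s constants-only side conditions.  NE7b NOT
PRINTED ∕ NOT PROVED; spine 0∕9.  HONEST DEPENDENCY (cell): continuum YM on T⁴ ⇐ BetaPertH ∧ nine spine estimates (0/9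
proved); BetaPertH ⇐ (D1) ∧ (D4) ∧ CAP+tail; G-an2-4 gates asym, D1 and NE2/3/4.  This file changes none of it. -/


open Finset MeasureTheory
open Literature.MathematicalPhysics.QuantumFieldTheory.Balaban1983to89
open T4PersistenceDictionary T4PersistentHistoryCount T4BankedInduction T4PrintedShapeBanking
open T4WeightBudget T4GlobalDenominator T4LiveClassFibration T4LiveStructureGas T4LiveGasToTerms T4RecordPriceSeam
open T4PartnerMultiplicity T4IndicatorShell T4MatchingAssembly T4MatchingClosure T4MatchingClosureSocket T4Continuum
open T4StabilitySocket T4BranchingRecordsGas T4TaggedShapeBanking T4CanonicalMenus T4RenewalChains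
open Summit.QuantumFields.BalabanUV.T4Continuum.PlacementBatch
open Summit.QuantumFields.BalabanUV.T4Continuum.PlacementSkeleton
open Summit.QuantumFields.BalabanUV.T4Continuum.CountThresholdUniform
open Summit.QuantumFields.BalabanUV.T4Continuum.CountThresholdExit
open Summit.QuantumFields.BalabanUV.T4Continuum.CountSeamJunction
open Summit.QuantumFields.BalabanUV.T4Continuum.LateMergers
open Summit.QuantumFields.BalabanUV.T4Continuum.HistoryFlow
open Summit.QuantumFields.BalabanUV.T4Continuum.HistoryRegeneration
open Summit.QuantumFields.BalabanUV.T4Continuum.HistoryTables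
open Summit.QuantumFields.BalabanUV.T4Continuum.HistoryAssemblyTrees
open Summit.QuantumFields.BalabanUV.T4Continuum.HistoryAssemblyTerms
open Summit.QuantumFields.BalabanUV.T4Continuum.HistoryAssemblyPedigree
open Summit.QuantumFields.BalabanUV.T4Continuum.HistoryConstants
open Summit.QuantumFields.BalabanUV.T4Continuum.HistoryGen
open Literature.MathematicalPhysics.QuantumFieldTheory.Balaban1983to89.B13ScaleTransfer
open Summit.QuantumFields.BalabanUV.T4Continuum.ZoneSkeleton
open Summit.QuantumFields.BalabanUV.T4Continuum.HistorySocketTH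
open Summit.QuantumFields.BalabanUV.T4Continuum.HistoryCaps
open Summit.QuantumFields.BalabanUV.T4Continuum.HistoryAssemblyPrice
open Summit.QuantumFields.BalabanUV.T4Continuum.HistoryBankingLE
open Summit.QuantumFields.BalabanUV.T4Continuum.HistoryExitLE
open Summit.QuantumFields.BalabanUV.T4Continuum.HistoryAssemblyTreesLE
open Summit.QuantumFields.BalabanUV.T4Continuum.HistoryAssemblyTermsLE
open Summit.QuantumFields.BalabanUV.T4Continuum.HistoryRealise
open Summit.QuantumFields.BalabanUV.T4Continuum.HistoryAssemblyRealiseLE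
open Summit.QuantumFields.BalabanUV.T4Continuum.HistoryAssemblyMult
open Summit.QuantumFields.BalabanUV.T4Continuum.HistoryAssemblyMultKey
open Summit.QuantumFields.BalabanUV.T4Continuum.HistoryAssemblyRealiseRun
open Summit.QuantumFields.BalabanUV.T4Continuum.HistoryAssemblyRealiseMult
open Summit.QuantumFields.BalabanUV.T4Continuum.HistoryZones
open Summit.QuantumFields.BalabanUV.T4Continuum.HistoryRealiseCells
open Summit.QuantumFields.BalabanUV.T4Continuum.HistoryRealiseCellsRun
open Summit.QuantumFields.BalabanUV.T4Continuum.HistoryAssemblyRealiseRunMult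

open Summit.QuantumFields.BalabanUV.T4Continuum.HistoryRealiseCellsRunMult
open Summit.QuantumFields.BalabanUV.T4Continuum.HistoryAssemblyMultInstance
open Summit.QuantumFields.BalabanUV.T4Continuum.HistoryJoinsPlacedMember
open Summit.QuantumFields.BalabanUV.T4Continuum.PlacementSkeleton
open Summit.QuantumFields.BalabanUV.T4Continuum.HistoryJoinsPlacedMult
open Summit.QuantumFields.BalabanUV.T4Continuum.HistoryRealiseDistinct
open Summit.QuantumFields.BalabanUV.T4Continuum.HistoryRegionTemplates
open Summit.QuantumFields.BalabanUV.T4Continuum.HistoryCaps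
open Summit.QuantumFields.BalabanUV.T4Continuum.HistoryZoneEvolve (cth)
open Literature.MathematicalPhysics.QuantumFieldTheory.Balaban1983to89.B16SProfile (DropCtl)

open Summit.QuantumFields.BalabanUV.T4Continuum.HistoryRealiseCellsRunMultEnd
open Summit.QuantumFields.BalabanUV.T4Continuum.HistoryRealiseCellsRunMultEndD

open Summit.QuantumFields.BalabanUV.T4Continuum.HistoryRealisePrint Summit.QuantumFields.BalabanUV.T4Continuum.HistoryRealiseWeak
open Summit.QuantumFields.BalabanUV.T4Continuum.HistoryRealisePrintReading Summit.QuantumFields.BalabanUV.T4Continuum.HistoryRealiseWeakReading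
open Summit.QuantumFields.BalabanUV.T4Continuum.HistoryRealisePrintCells Summit.QuantumFields.BalabanUV.T4Continuum.HistoryRealiseWeakCells
open Summit.QuantumFields.BalabanUV.T4Continuum.HistoryRealiseCellsRunPinnedT3b
open Summit.QuantumFields.BalabanUV.T4Continuum.HistoryRealiseCellsRunMultEndDWTV
open Summit.QuantumFields.BalabanUV.T4Continuum.HistoryBankingVolumePlug (birthWT)
namespace Summit.QuantumFields.BalabanUV.T4Continuum.HistoryRealiseCellsRunPinnedT3bWTV

noncomputable section

universe u v w

section Pinned

variable {F : T4Family} {G : Type*} [GaugeGroup G] [MeasurableSpace G] [HaarData G] [RegularGaugeGroup G]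

/-- **THE END OF RECORD v3′ UNDER THE TWO PINS, MEMORY-AGNOSTIC CARRIER, `κ := costT`, WEIGHTED CLASS REMAINDER DISPLAYED**
(IR-44-1 (2), E4TV): E4T's `hybridNE7_of_realisedDomainsRunW_pinnedT3bDT` with the realised-cost binders `κ κ′` and their
total-form readings REPLACED by the displayed weight family `uV` + D-V1, the price sentences at `costT Prod.fst C K (R K)`
carrying `Real.exp (birthWT Prod.fst (uV K) q.2)`, and the slack `C.a + (θ + θᵥ) ≤ ½γ₀A₁²`; quantifier order and every
other binder = E4T's (hence W7TV's after `D.Tuned γ g g₀ →`); conclusion VERBATIM.  NE7b NOT proved. [folklore] -/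
theorem hybridNE7_of_realisedDomainsRunW_pinnedT3bDTV (D : FiniteEpsData F G)
    -- the two pins, BY NAME, and the sign conventions of the datum
    (hB : B16.EndStatementBPrinted D.C) (hβ : BetaPertHyp D.βfun) (hsign : B16.SignConventions D.C)
    -- the constants (symbolic, c2∕c6) and their side conditions; NO `Dominates` on the slack road
    {C : T4PrintedShapeBanking.Consts} {O : PrintedO1s}
    {rr : ℕ} {β₀ : ℝ} (h : ThresholdOK C F.L rr β₀) (hμ : 0 < C.μ) (d n : ℕ)
    (hκ₁ : (d : ℝ) * Real.log F.L + 2 * Real.log 2 ≤ C.κ₁) (hE₀ : Real.log (2 + birthMass C) ≤ C.E₀)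
    (hA₀ : 1 ≤ C.A₀) (hβ₀ : 0 < β₀) (hLβ : (F.L : ℝ) * β₀ ≤ 1) (hn₁ : 13 ≤ C.n₁) (hn : 0 < n)
    -- the class-linear slack `C.a + θ ≤ ½γ₀A₁²` and row S6g′'s instance: stride `sS`, decay `θc`, their arithmetic side
    -- conditions, the signs of the floor ∕ size constants, and `θ` above the instance's class-linear constant (verbatim)
    {θ θv : ℝ} (hθ : 0 ≤ θ) (hslack : C.a + (θ + θv) ≤ O.γ₀ * O.A₁ ^ 2 / 2)
    (hE₂ : 0 < C.E₂) (hE₃ : 0 ≤ C.E₃) {sS : ℕ} (hsS : 1 ≤ sS)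
    (hsmall : (((2 * cth 32 1 sS + 1) ^ d : ℕ) : ℝ) * (5 : ℝ) ^ d * ((max 1 (2 * 32 + 2) : ℕ) : ℝ) ≤
      (F.L : ℝ) ^ (sS / 2) / 2)
    {θc : ℝ} (hθc0 : 0 ≤ θc) (hθc1 : θc < 1) (hθcs : 1 / 2 ≤ θc ^ sS)
    (hθJ : (2 +
            ((2 * (((2 * cth 32 1 sS + 1) ^ d : ℕ) : ℝ) * ((((2 * 32 + 1) ^ d : ℕ) : ℝ) * (4 * 2 ^ d)) +
                  4 * ((((2 * cth 32 1 sS + 1) ^ d : ℕ) : ℝ) * (5 : ℝ) ^ d)) / (1 - θc) +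
              2 * (2 * ((((2 * cth 32 1 sS + 1) ^ d : ℕ) : ℝ) * (5 : ℝ) ^ d))) +
            (2 * ((0 + 2 * Real.log (2 * d + 1)) + (2 * (d : ℝ) + 2 * Real.log (2 * d + 1)) *
                  (((max 1 (2 * 32 + 2) : ℕ) : ℝ) * (2 * ((((2 * cth 32 1 sS + 1) ^ d : ℕ) : ℝ) * (5 : ℝ) ^ d)))) +
              (2 * (d : ℝ) + 2 * Real.log (2 * d + 1)) * 1 *
                (((max 1 (2 * 32 + 2) : ℕ) : ℝ) *
                    ((2 * (((2 * cth 32 1 sS + 1) ^ d : ℕ) : ℝ) * ((((2 * 32 + 1) ^ d : ℕ) : ℝ) * (4 * 2 ^ d)) +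
                        4 * ((((2 * cth 32 1 sS + 1) ^ d : ℕ) : ℝ) * (5 : ℝ) ^ d)) / (1 - θc)) +
                  4 * 2 ^ d)) +
            10) + 8 * 2 ^ d * Real.log (2 * d + 1) ≤ θ) :
    ∃ γ₁ : ℝ, 0 < γ₁ ∧ ∀ γ : ℝ, 0 < γ → γ ≤ γ₁ → ∃ g₁ : ℝ, 0 < g₁ ∧ ∀ g : ℝ, 0 < g → g ≤ g₁ →
      ∃ Em : ℝ, 0 ≤ Em ∧ ∀ g₀ : ℕ → ℝ, D.Tuned γ g g₀ →
      ∀ {ι : Type u} [DecidableEq ι] {α : Type v} {π : Type w} [DecidableEq α] [DecidableEq π]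
        (l₀ vol : ℝ) (K₀ : ℕ) (T : ℕ → Finset ι) (A A' shA shB dead dead' : ℕ → ℝ → ι → ℝ)
        (nup mup : ℕ → ℝ → ℝ) (Nup : ℝ) (Cc Rr CcRec RrRec : ℕ → ℝ → ι → ℝ) (ν u s₂ q₀ r s Wsh : ℕ → ℝ)
        -- the observable and the two runs' (α) integral bounds, floors, site budgets, envelopes ((B) side, displayed)
        (obs : (K : ℕ) → GaugeField (F.P K) 0 G → ℝ) (B : ℝ),
        (∀ K, Measurable (obs K)) → (∀ K U, |obs K U| ≤ B) →
        (∀ K t, |t| ≤ l₀ → K₀ ≤ K →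
          ∫ U, Real.exp (t * obs K U) * D.dens K (g₀ K) 0 U ∂fieldMeasure (F.P K) 0 G ≤ ∑ τ ∈ T K, A K t τ) →
        (∀ K t, |t| ≤ l₀ → K₀ ≤ K →
          ∫ U, Real.exp (t * obs (K + 1) U) * D.dens (K + 1) (g₀ (K + 1)) 0 U ∂fieldMeasure (F.P (K + 1)) 0 G ≤
          ∑ τ ∈ T K, A' K t τ) →
      ∀ (c₀ n₁ : ℝ), 0 < c₀ → (∀ K, K₀ ≤ K → c₀ ≤ smallFieldMass D K (g₀ K)) →
        (∀ K, K₀ ≤ K → c₀ ≤ smallFieldMass D (K + 1) (g₀ (K + 1))) →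
        (∀ K, K₀ ≤ K → ((D.C ⟨K, F.m, g₀ K⟩).numSites K : ℝ) ≤ n₁) →
        (∀ K, K₀ ≤ K → ((D.C ⟨K + 1, F.m, g₀ (K + 1)⟩).numSites (K + 1) : ℝ) ≤ n₁) →
        0 ≤ Nup → (∀ K t, |t| ≤ l₀ → K₀ ≤ K → 0 ≤ nup K t ∧ nup K t ≤ Nup) →
        (∀ K t, |t| ≤ l₀ → K₀ ≤ K → 0 ≤ mup K t ∧ mup K t ≤ Nup) →
      -- the (2.5) side condition on the size function
      ∀ (R : ℕ → ℕ → ℕ), (∀ K s, s ≤ K → B14.IsRj F.L rr ((D.C ⟨K, F.m, g₀ K⟩).flow.g s) (R K s)) →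
        (∀ K, K₀ ≤ K → ∀ t, 1 ≤ R K t) →
      -- H3: the terms read as pedigrees REALISED BY THE RUN'S OWN PROFILE with their DOMAINS
      ∀ (ped : ℕ → ι → Pedigree α π) (cellP : ℕ → ι → π → Pt d × Finset (Pt d)) (liveC : ℕ → ι → Finset α)
        (Zd : ℕ → ι → α → Finset (Pt d)),
        RealisedDomainsRW F.L (runProfile F.L R) n K₀ R T ped cellP liveC Zd →
      -- H3: live components dated no later than the cutoff; DISJOINT partners at every join and BOXED constituents at
      -- their birth levels (row S1c-opt's reading clauses)
        (∀ K, K₀ ≤ K → ∀ τ ∈ T K, ∀ c ∈ liveC K τ, (ped K τ).step c ≤ K) →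
        (∀ K, K₀ ≤ K → ∀ τ ∈ T K, ∀ c ∈ liveC K τ, DisjointJoins ((ped K τ).toPGen (cellP K τ) c)) →
        (∀ K, K₀ ≤ K → ∀ τ ∈ T K, ∀ c ∈ liveC K τ,
          BoxedBirths n F.L K (levelOf (runProfile F.L R K) K) ((ped K τ).toPGen (cellP K τ) c)) →
      -- M5-2 (IR-44-1): the volume remainder's displayed WEIGHT FAMILY and its display D-V1 at the priced members' births
      ∀ (uV : ℕ → ℕ → ℝ),
        (∀ K, K₀ ≤ K → ∀ τ ∈ badTerms (memOf ped liveC (cellOfR n F.L (runProfile F.L R) ped cellP)) jhalf T K, ∀ q ∈ memOf ped liveC (cellOfR n F.L (runProfile F.L R) ped cellP) K τ,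
          ∀ e ∈ q.2.events, (Prod.fst e).kind = 0 →
            uV K (Prod.fst e).step ≤ θv * p0Profile C.A₀ C.p₀ ((D.C ⟨K, F.m, g₀ K⟩).flow.g (Prod.fst e).step) ^ 2) →
      -- H3: the per-term price sentence over the named members in PRINT's currency AT `κ := costT`, with the volume
      -- remainder's weighted class factor, discounted by `exp(−Ξ)`; both runs
      ∀ (FcM RfM FcM' RfM' : ℕ → Finset ((Fin d → ℕ) × Gen PEv × Multiset (PEv × ((Fin d → ℕ) × Finset (Pt d)))) → ℝ),
        (∀ K t, |t| ≤ l₀ → K₀ ≤ K → ∀ τ ∈ badTerms (memOf ped liveC (cellOfR n F.L (runProfile F.L R) ped cellP)) jhalf T K,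
          FcM K (kmemOf ped liveC (cellOfR n F.L (runProfile F.L R) ped cellP) (physV n F.L hn (Nat.lt_of_lt_of_le Nat.zero_lt_two (two_le_L F))
          (fun K => tcap d (dcapOf Prod.fst T (memOf ped liveC (cellOfR n F.L (runProfile F.L R) ped cellP)) K))
          (fun K => one_le_tcap d (dcapOf Prod.fst T (memOf ped liveC (cellOfR n F.L (runProfile F.L R) ped cellP)) K)) (runProfile F.L R) ped cellP) K τ) * RfM K (kmemOf ped liveC (cellOfR n F.L (runProfile F.L R) ped cellP) (physV n F.L hn (Nat.lt_of_lt_of_le Nat.zero_lt_two (two_le_L F))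
          (fun K => tcap d (dcapOf Prod.fst T (memOf ped liveC (cellOfR n F.L (runProfile F.L R) ped cellP)) K))
          (fun K => one_le_tcap d (dcapOf Prod.fst T (memOf ped liveC (cellOfR n F.L (runProfile F.L R) ped cellP)) K)) (runProfile F.L R) ped cellP) K τ) ≤
          ∏ q ∈ memOf ped liveC (cellOfR n F.L (runProfile F.L R) ped cellP) K τ,
          pshapeTH Prod.fst O C 1 1 (R K) (D.C ⟨K, F.m, g₀ K⟩).flow.g 0 (costT Prod.fst C K (R K)) q.2 * Real.exp (birthWT Prod.fst (uV K) q.2) *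
            Real.exp (-(8 / C.E₂ * totalCostT Prod.fst C K (R K) q.2 + 4 * (partnerAges (PEv.step ∘ Prod.fst) q.2 : ℝ)))) →
        (∀ K t, |t| ≤ l₀ → K₀ ≤ K → ∀ τ ∈ badTerms (memOf ped liveC (cellOfR n F.L (runProfile F.L R) ped cellP)) jhalf T K,
          FcM' K (kmemOf ped liveC (cellOfR n F.L (runProfile F.L R) ped cellP) (physV n F.L hn (Nat.lt_of_lt_of_le Nat.zero_lt_two (two_le_L F))
          (fun K => tcap d (dcapOf Prod.fst T (memOf ped liveC (cellOfR n F.L (runProfile F.L R) ped cellP)) K))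
          (fun K => one_le_tcap d (dcapOf Prod.fst T (memOf ped liveC (cellOfR n F.L (runProfile F.L R) ped cellP)) K)) (runProfile F.L R) ped cellP) K τ) * RfM' K (kmemOf ped liveC (cellOfR n F.L (runProfile F.L R) ped cellP) (physV n F.L hn (Nat.lt_of_lt_of_le Nat.zero_lt_two (two_le_L F))
          (fun K => tcap d (dcapOf Prod.fst T (memOf ped liveC (cellOfR n F.L (runProfile F.L R) ped cellP)) K))
          (fun K => one_le_tcap d (dcapOf Prod.fst T (memOf ped liveC (cellOfR n F.L (runProfile F.L R) ped cellP)) K)) (runProfile F.L R) ped cellP) K τ) ≤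
          ∏ q ∈ memOf ped liveC (cellOfR n F.L (runProfile F.L R) ped cellP) K τ,
          pshapeTH Prod.fst O C 1 1 (R K) (D.C ⟨K, F.m, g₀ K⟩).flow.g 0 (costT Prod.fst C K (R K)) q.2 * Real.exp (birthWT Prod.fst (uV K) q.2) *
            Real.exp (-(8 / C.E₂ * totalCostT Prod.fst C K (R K) q.2 + 4 * (partnerAges (PEv.step ∘ Prod.fst) q.2 : ℝ)))) →
      -- H3: the remaining `Regeneration` numerator readings, over the PHYSICAL member families (run A, then run B)
        (∀ K t, |t| ≤ l₀ → K₀ ≤ K →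
          ∀ k ∈ badGMems (memOf ped liveC (cellOfR n F.L (runProfile F.L R) ped cellP)) jhalf T (kmemOf ped liveC (cellOfR n F.L (runProfile F.L R) ped cellP) (physV n F.L hn (Nat.lt_of_lt_of_le Nat.zero_lt_two (two_le_L F))
          (fun K => tcap d (dcapOf Prod.fst T (memOf ped liveC (cellOfR n F.L (runProfile F.L R) ped cellP)) K))
          (fun K => one_le_tcap d (dcapOf Prod.fst T (memOf ped liveC (cellOfR n F.L (runProfile F.L R) ped cellP)) K)) (runProfile F.L R) ped cellP)) K,
          ∀ τ ∈ fibre (kmemOf ped liveC (cellOfR n F.L (runProfile F.L R) ped cellP) (physV n F.L hn (Nat.lt_of_lt_of_le Nat.zero_lt_two (two_le_L F))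
          (fun K => tcap d (dcapOf Prod.fst T (memOf ped liveC (cellOfR n F.L (runProfile F.L R) ped cellP)) K))
          (fun K => one_le_tcap d (dcapOf Prod.fst T (memOf ped liveC (cellOfR n F.L (runProfile F.L R) ped cellP)) K)) (runProfile F.L R) ped cellP)) T K k, A K t τ ≤ dead K t τ * FcM K k * nup K t) →
        (∀ K t, |t| ≤ l₀ → K₀ ≤ K →
          ∀ k ∈ badGMems (memOf ped liveC (cellOfR n F.L (runProfile F.L R) ped cellP)) jhalf T (kmemOf ped liveC (cellOfR n F.L (runProfile F.L R) ped cellP) (physV n F.L hn (Nat.lt_of_lt_of_le Nat.zero_lt_two (two_le_L F))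
          (fun K => tcap d (dcapOf Prod.fst T (memOf ped liveC (cellOfR n F.L (runProfile F.L R) ped cellP)) K))
          (fun K => one_le_tcap d (dcapOf Prod.fst T (memOf ped liveC (cellOfR n F.L (runProfile F.L R) ped cellP)) K)) (runProfile F.L R) ped cellP)) K,
          ∀ τ ∈ fibre (kmemOf ped liveC (cellOfR n F.L (runProfile F.L R) ped cellP) (physV n F.L hn (Nat.lt_of_lt_of_le Nat.zero_lt_two (two_le_L F))
          (fun K => tcap d (dcapOf Prod.fst T (memOf ped liveC (cellOfR n F.L (runProfile F.L R) ped cellP)) K))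
          (fun K => one_le_tcap d (dcapOf Prod.fst T (memOf ped liveC (cellOfR n F.L (runProfile F.L R) ped cellP)) K)) (runProfile F.L R) ped cellP)) T K k, 0 ≤ dead K t τ) →
        (∀ K t, |t| ≤ l₀ → K₀ ≤ K →
          ∀ k ∈ badGMems (memOf ped liveC (cellOfR n F.L (runProfile F.L R) ped cellP)) jhalf T (kmemOf ped liveC (cellOfR n F.L (runProfile F.L R) ped cellP) (physV n F.L hn (Nat.lt_of_lt_of_le Nat.zero_lt_two (two_le_L F))
          (fun K => tcap d (dcapOf Prod.fst T (memOf ped liveC (cellOfR n F.L (runProfile F.L R) ped cellP)) K))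
          (fun K => one_le_tcap d (dcapOf Prod.fst T (memOf ped liveC (cellOfR n F.L (runProfile F.L R) ped cellP)) K)) (runProfile F.L R) ped cellP)) K,
          ∑ τ ∈ fibre (kmemOf ped liveC (cellOfR n F.L (runProfile F.L R) ped cellP) (physV n F.L hn (Nat.lt_of_lt_of_le Nat.zero_lt_two (two_le_L F))
          (fun K => tcap d (dcapOf Prod.fst T (memOf ped liveC (cellOfR n F.L (runProfile F.L R) ped cellP)) K))
          (fun K => one_le_tcap d (dcapOf Prod.fst T (memOf ped liveC (cellOfR n F.L (runProfile F.L R) ped cellP)) K)) (runProfile F.L R) ped cellP)) T K k, dead K t τ ≤ RfM K k) →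
        (∀ K t, |t| ≤ l₀ → K₀ ≤ K →
          ∀ k ∈ badGMems (memOf ped liveC (cellOfR n F.L (runProfile F.L R) ped cellP)) jhalf T (kmemOf ped liveC (cellOfR n F.L (runProfile F.L R) ped cellP) (physV n F.L hn (Nat.lt_of_lt_of_le Nat.zero_lt_two (two_le_L F))
          (fun K => tcap d (dcapOf Prod.fst T (memOf ped liveC (cellOfR n F.L (runProfile F.L R) ped cellP)) K))
          (fun K => one_le_tcap d (dcapOf Prod.fst T (memOf ped liveC (cellOfR n F.L (runProfile F.L R) ped cellP)) K)) (runProfile F.L R) ped cellP)) K, 0 ≤ FcM K k) →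
        (∀ K t, |t| ≤ l₀ → K₀ ≤ K →
          ∀ k ∈ badGMems (memOf ped liveC (cellOfR n F.L (runProfile F.L R) ped cellP)) jhalf T (kmemOf ped liveC (cellOfR n F.L (runProfile F.L R) ped cellP) (physV n F.L hn (Nat.lt_of_lt_of_le Nat.zero_lt_two (two_le_L F))
          (fun K => tcap d (dcapOf Prod.fst T (memOf ped liveC (cellOfR n F.L (runProfile F.L R) ped cellP)) K))
          (fun K => one_le_tcap d (dcapOf Prod.fst T (memOf ped liveC (cellOfR n F.L (runProfile F.L R) ped cellP)) K)) (runProfile F.L R) ped cellP)) K,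
          ∀ τ ∈ fibre (kmemOf ped liveC (cellOfR n F.L (runProfile F.L R) ped cellP) (physV n F.L hn (Nat.lt_of_lt_of_le Nat.zero_lt_two (two_le_L F))
          (fun K => tcap d (dcapOf Prod.fst T (memOf ped liveC (cellOfR n F.L (runProfile F.L R) ped cellP)) K))
          (fun K => one_le_tcap d (dcapOf Prod.fst T (memOf ped liveC (cellOfR n F.L (runProfile F.L R) ped cellP)) K)) (runProfile F.L R) ped cellP)) T K k, A' K t τ ≤ dead' K t τ * FcM' K k * mup K t) →
        (∀ K t, |t| ≤ l₀ → K₀ ≤ K →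
          ∀ k ∈ badGMems (memOf ped liveC (cellOfR n F.L (runProfile F.L R) ped cellP)) jhalf T (kmemOf ped liveC (cellOfR n F.L (runProfile F.L R) ped cellP) (physV n F.L hn (Nat.lt_of_lt_of_le Nat.zero_lt_two (two_le_L F))
          (fun K => tcap d (dcapOf Prod.fst T (memOf ped liveC (cellOfR n F.L (runProfile F.L R) ped cellP)) K))
          (fun K => one_le_tcap d (dcapOf Prod.fst T (memOf ped liveC (cellOfR n F.L (runProfile F.L R) ped cellP)) K)) (runProfile F.L R) ped cellP)) K,
          ∀ τ ∈ fibre (kmemOf ped liveC (cellOfR n F.L (runProfile F.L R) ped cellP) (physV n F.L hn (Nat.lt_of_lt_of_le Nat.zero_lt_two (two_le_L F))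
          (fun K => tcap d (dcapOf Prod.fst T (memOf ped liveC (cellOfR n F.L (runProfile F.L R) ped cellP)) K))
          (fun K => one_le_tcap d (dcapOf Prod.fst T (memOf ped liveC (cellOfR n F.L (runProfile F.L R) ped cellP)) K)) (runProfile F.L R) ped cellP)) T K k, 0 ≤ dead' K t τ) →
        (∀ K t, |t| ≤ l₀ → K₀ ≤ K →
          ∀ k ∈ badGMems (memOf ped liveC (cellOfR n F.L (runProfile F.L R) ped cellP)) jhalf T (kmemOf ped liveC (cellOfR n F.L (runProfile F.L R) ped cellP) (physV n F.L hn (Nat.lt_of_lt_of_le Nat.zero_lt_two (two_le_L F))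
          (fun K => tcap d (dcapOf Prod.fst T (memOf ped liveC (cellOfR n F.L (runProfile F.L R) ped cellP)) K))
          (fun K => one_le_tcap d (dcapOf Prod.fst T (memOf ped liveC (cellOfR n F.L (runProfile F.L R) ped cellP)) K)) (runProfile F.L R) ped cellP)) K,
          ∑ τ ∈ fibre (kmemOf ped liveC (cellOfR n F.L (runProfile F.L R) ped cellP) (physV n F.L hn (Nat.lt_of_lt_of_le Nat.zero_lt_two (two_le_L F))
          (fun K => tcap d (dcapOf Prod.fst T (memOf ped liveC (cellOfR n F.L (runProfile F.L R) ped cellP)) K))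
          (fun K => one_le_tcap d (dcapOf Prod.fst T (memOf ped liveC (cellOfR n F.L (runProfile F.L R) ped cellP)) K)) (runProfile F.L R) ped cellP)) T K k, dead' K t τ ≤ RfM' K k) →
        (∀ K t, |t| ≤ l₀ → K₀ ≤ K →
          ∀ k ∈ badGMems (memOf ped liveC (cellOfR n F.L (runProfile F.L R) ped cellP)) jhalf T (kmemOf ped liveC (cellOfR n F.L (runProfile F.L R) ped cellP) (physV n F.L hn (Nat.lt_of_lt_of_le Nat.zero_lt_two (two_le_L F))
          (fun K => tcap d (dcapOf Prod.fst T (memOf ped liveC (cellOfR n F.L (runProfile F.L R) ped cellP)) K))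
          (fun K => one_le_tcap d (dcapOf Prod.fst T (memOf ped liveC (cellOfR n F.L (runProfile F.L R) ped cellP)) K)) (runProfile F.L R) ped cellP)) K, 0 ≤ FcM' K k) →
      -- the seam's other inputs: NE7c's shell weight bound, NE7's core budget, four summable rates
        ShellWeightBound l₀ T A A' shA shB Wsh →
        ReindexedBudget l₀ vol T (fun K t τ => A K t τ - shA K t τ) (fun K t τ => A' K t τ - shB K t τ)
          (badOfClass (bstrOf Prod.fst (memOf ped liveC (cellOfR n F.L (runProfile F.L R) ped cellP))) T
          (fun K _ => badClasses Prod.fst (memOf ped liveC (cellOfR n F.L (runProfile F.L R) ped cellP)) jhalf T K)) Cc Rr CcRec RrRec ν u s₂ q₀ r s →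
        Summable r → Summable u → Summable s → Summable s₂ →
    ∃ K₁ K₂, K₀ ≤ K₁ ∧ HybridNE7 l₀ vol (fun K => T (K₁ + (K₂ + K))) (fun K => A (K₁ + (K₂ + K)))
      (fun K => A' (K₁ + (K₂ + K)))
      (fun K => badOfClass (bstrOf Prod.fst (memOf ped liveC (cellOfR n F.L (runProfile F.L R) ped cellP))) T
        (fun K _ => badClasses Prod.fst (memOf ped liveC (cellOfR n F.L (runProfile F.L R) ped cellP)) jhalf T K) (K₁ + (K₂ + K)))
      (fun K => constOf l₀ B Em n₁ c₀ Nup *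
        recordsBudget (birthMass C) C.κ₁ ((n : ℝ) ^ d) ((F.L : ℝ) ^ d) (Real.log 2) jhalf (K₁ + (K₂ + K)))
      (fun K => shA (K₁ + (K₂ + K))) (fun K => shB (K₁ + (K₂ + K))) (fun K => Wsh (K₁ + (K₂ + K)))
      (fun K => (r (K₁ + (K₂ + K)) + u (K₁ + (K₂ + K))) + (s (K₁ + (K₂ + K)) + s₂ (K₁ + (K₂ + K)))) := by
  -- thresholds: the flow side from `BetaPertHyp`, the (B) side from the pin, the infrared clause from `g₁`
  obtain ⟨hβ₁, hβhalf⟩ := HistoryRealiseCellsRunPinned.beta0_le_of_L_mul_le (F := F) hLβ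
  obtain ⟨γ₀, b, β', _hγ₀, hb, _hbβ, hlo, hhi, γf, hγf, hγf₀, hS⟩ :=
    flowSide_of_betaPertHyp D hβ hβ₀ hβ₁ hLβ (max C.p₀ rr)
  obtain ⟨γB, hγB, em, ep, hcor⟩ := hB.2
  refine ⟨min γf γB, lt_min hγf hγB, fun γ hγ hγle => ?_⟩
  obtain ⟨hSm, hγβ⟩ := hS γ hγ (hγle.trans (min_le_left _ _))
  refine ⟨min 1 (Real.exp (-(irThresholdTLE C F.L rr β₀) / 2)), lt_min one_pos (Real.exp_pos _),
    fun g hg hgle => ⟨max (em g) 0, le_max_right _ _, fun g₀ ht => ?_⟩⟩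
  have hir : irThresholdTLE C F.L rr β₀ ≤ Real.log (g ^ 2)⁻¹ :=
    HistoryRealiseCellsRunPinned.le_log_inv_sq_of_le_exp hg (hgle.trans (min_le_right _ _))
  intro ι _ α π _ _ l₀ vol K₀ T A A' shA shB dead dead' nup mup Nup Cc Rr CcRec RrRec ν u s₂ q₀ r s Wsh obs B hobs
    hbd hα hα' c₀ n₁ hc₀ hfloor hfloor' hsites hsites' hNup hnup hmup R hR hR1 ped cellP liveC Zd H hstep hDJ hBB uV huV
    FcM RfM FcM' RfM' hPM hPM' upM deadM_nonneg resumM FM_nonneg upM' deadM'_nonneg resumM' FM'_nonneg hSh hTB hr hu hs hs₂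
  exact hybridNE7_of_realisedDomainsRunW_printedT3bDTV D h hμ d n hκ₁ hE₀ hA₀ hb.le hlo hhi
    (hγle.trans ((min_le_left _ _).trans hγf₀)) hγβ hSm (le_max_left _ _) (le_max_right _ _) hβhalf ht hir hsign
    hcor (hγle.trans (min_le_right _ _)) hobs hbd hα hα' hc₀ hfloor hfloor' hsites hsites' hNup hnup hmup R hR
    (HistoryRealiseCellsRunPinned.four_le_L F) hn₁ hR1 ped cellP liveC Zd H hn hstep hDJ hBB hθ hslack hE₂ hE₃ hsS hsmall
    hθc0 hθc1 hθcs hθJ uV huV hPM hPM' upM deadM_nonneg resumM FM_nonneg upM' deadM'_nonneg resumM' FM'_nonneg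
    hSh hTB hr hu hs hs₂

end Pinned

end

end Summit.QuantumFields.BalabanUV.T4Continuum.HistoryRealiseCellsRunPinnedT3bWTV
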